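import Mathlib.Analysis.InnerProductSpace.Adjoint
import Mathlib.Algebra.Group.TransferInstance
import Mathlib.LinearAlgebra.Complex.Module
import Literature.Analysis.UnboundedOperators.UnitaryRep
import Literature.Analysis.UnboundedOperators.UnitaryGroupGenerator
import HarnessLib

/-!
# Complexification of a real Hilbert space; real orthogonal groups as one-parameter unitary groups

Topic `Literature/Analysis/UnboundedOperators` (next to `UnitaryRep`, `ConjugateOperatorRegularity`);
part of the definition request `defn-InfiniteHardSphereDynamics-3` ("Alexander's flow … as a
UNITARY Koopman group", route `MourreKoopmanCharges` of `AtomisticToContinuum/HydrodynamicLimit`,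
crux `CollisionCommutatorRegularityR`): the Koopman group of a measure-preserving flow on Spohn's
fluctuation space (`Literature.MathematicalPhysics.KineticTheory.FluctuationDynamics.koopman`) is a
group of REAL linear isometries of a REAL Hilbert space, whereas the tree's spectral / commutator
vocabulary (`OneParameterUnitaryGroup`, `UnitaryRep.hamiltonian` = Stone generator,
`UnitaryRep.HamiltonianOfClassC1`, `UnitaryRep.HasMourreEstimateOn`, …) lives on COMPLEX Hilbert
spaces (as it must: `ConjugateOperatorRegularity.lean`, "Real Hilbert spaces"). This file is the
missing generic bridge.

## Contents

* `Complexification E` — the complexification `E_ℂ = E ⊕ iE` of a real vector space, as pairs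
  `⟨re, im⟩ = x + iy`, with the complex scalar action `(a + ib)(x + iy) = (ax - by) + i(ay + bx)`;
  for a real inner product space the complex inner product
  `⟪x + iy, x' + iy'⟫ = ⟪x, x'⟫ + ⟪y, y'⟫ + i(⟪x, y'⟫ - ⟪y, x'⟫)` (conjugate-linear in the first
  variable, Mathlib's convention), `‖x + iy‖² = ‖x‖² + ‖y‖²` (`norm_sq`), completeness
  (`instCompleteSpace`), the isometric embedding `ofReal : E →ₗᵢ[ℝ] E_ℂ`, the real-linear
  homeomorphism `prodL : E_ℂ ≃L[ℝ] E × E`, and the complexified subspace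
  `Complexification.submodule S = S ⊕ iS` of a real subspace (`submodule_le_submodule_iff`).
* `Complexification.map T = T_ℂ`, `T_ℂ(x + iy) = Tx + iTy`, the complexification of a bounded real
  operator (functorial: `map_id`, `map_comp`; `‖T_ℂ u‖ = ‖u‖` and `T_ℂ` unitary when `T` is a
  surjective isometry, `map_mem_unitary`).
* `Complexification.unitaryGroupOfReal`: a strongly continuous one-parameter group
  `V : ℝ → (E →L[ℝ] E)` of real linear isometries (`V 0 = 1`, `V (s + t) = V s ∘ V t`,
  `‖V t x‖ = ‖x‖`, `t ↦ V t x` continuous) complexifies to a `OneParameterUnitaryGroup E_ℂ`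
  (`U(t) = (V t)_ℂ`), so that its Stone generator `UnitaryRep.hamiltonian`, invariant vectors,
  Mourre-type regularity classes etc. become available; `mem_invariantVectors_unitaryGroupOfReal_iff`
  (a vector is invariant iff its real and imaginary parts are), and
  `hamiltonian_unitaryGroupOfReal_ofReal` (a real orbit differentiable at `0` with derivative `y`
  gives `x + i0 ∈ D(H)` and `H(x + i0) = -i(y + i0)`: the Stone generator extends the real one).

## Design choices

* `Complexification E` is a two-field structure, not a type synonym of `E × E` (whose sup norm and
  real module structure must not be inherited); the additive group is transferred along
  `equivProd`, the norm and inner product come from an `InnerProductSpace.Core` (Mathlib's pattern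
  for `Quaternion`), the real structure back from `Module.complexToReal` / `NormedSpace.complexToReal`
  (`real_smul_re`, `real_smul_im`).
* Only what the Koopman application needs: no complexification of unbounded operators, of
  antilinear maps, or of `E →L[ℝ] F` between different spaces.

## References

Standard linear algebra / functional analysis (complexification of a real inner product space and
of bounded real operators; e.g. the remark "Real Hilbert spaces" in the module docstring of
`ConjugateOperatorRegularity.lean`). All statements here are folklore.
-/

noncomputable section

open Filter
open scoped InnerProductSpace ComplexConjugate
open scoped _root_.Topology

namespace Literature.Analysis.UnboundedOperators

/-- The **complexification** `E_ℂ = E ⊕ iE = {x + iy | x, y ∈ E}` of a real vector space `E`,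
recorded as the pair of its real part `x` and imaginary part `y`. For a real inner product space it
carries the complex inner product `⟪x + iy, x' + iy'⟫ = ⟪x, x'⟫ + ⟪y, y'⟫ + i(⟪x, y'⟫ - ⟪y, x'⟫)`
and the norm `‖x + iy‖² = ‖x‖² + ‖y‖²`. [folklore] -/
@[ext]
structure Complexification (E : Type*) where
  /-- The real part `x` of `x + iy`. -/
  re : E
  /-- The imaginary part `y` of `x + iy`. -/
  im : E

namespace Complexification

variable {E : Type*}

/-! ## §1. Module structure -/

section Module

variable [AddCommGroup E]

/-- `E_ℂ ≃ E × E`, `x + iy ↦ (x, y)` (transfers the additive group structure). [folklore] -/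
def equivProd : Complexification E ≃ E × E where
  toFun u := (u.re, u.im)
  invFun p := ⟨p.1, p.2⟩
  left_inv _ := rfl
  right_inv _ := rfl

/-- Componentwise addition on `E_ℂ`. [folklore] -/
instance instAddCommGroup : AddCommGroup (Complexification E) :=
  (equivProd (E := E)).addCommGroup

/-- `re (u + v) = re u + re v`. [folklore] -/
@[simp] theorem add_re (u v : Complexification E) : (u + v).re = u.re + v.re := rfl

/-- `im (u + v) = im u + im v`. [folklore] -/
@[simp] theorem add_im (u v : Complexification E) : (u + v).im = u.im + v.im := rfl

/-- `re 0 = 0`. [folklore] -/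
@[simp] theorem zero_re : (0 : Complexification E).re = 0 := rfl

/-- `im 0 = 0`. [folklore] -/
@[simp] theorem zero_im : (0 : Complexification E).im = 0 := rfl

/-- `re (-u) = -re u`. [folklore] -/
@[simp] theorem neg_re (u : Complexification E) : (-u).re = -u.re := rfl

/-- `im (-u) = -im u`. [folklore] -/
@[simp] theorem neg_im (u : Complexification E) : (-u).im = -u.im := rfl

/-- `re (u - v) = re u - re v`. [folklore] -/
@[simp] theorem sub_re (u v : Complexification E) : (u - v).re = u.re - v.re := rfl

/-- `im (u - v) = im u - im v`. [folklore] -/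
@[simp] theorem sub_im (u v : Complexification E) : (u - v).im = u.im - v.im := rfl

variable [Module ℝ E]

/-- Complex scalars act by `(a + ib)(x + iy) = (ax - by) + i(ay + bx)`. [folklore] -/
instance instSMul : SMul ℂ (Complexification E) :=
  ⟨fun c u => ⟨c.re • u.re - c.im • u.im, c.re • u.im + c.im • u.re⟩⟩

/-- Real part of `c • u`. [folklore] -/
@[simp] theorem smul_re (c : ℂ) (u : Complexification E) :
    (c • u).re = c.re • u.re - c.im • u.im := rfl

/-- Imaginary part of `c • u`. [folklore] -/
@[simp] theorem smul_im (c : ℂ) (u : Complexification E) :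
    (c • u).im = c.re • u.im + c.im • u.re := rfl

/-- `E_ℂ` is a complex vector space. [folklore] -/
instance instModule : Module ℂ (Complexification E) where
  one_smul u := by ext <;> simp
  mul_smul a b u := by
    ext <;> simp only [smul_re, smul_im, Complex.mul_re, Complex.mul_im] <;> module
  smul_zero a := by ext <;> simp
  smul_add a u v := by ext <;> simp only [smul_re, smul_im, add_re, add_im] <;> module
  add_smul a b u := by
    ext <;> simp only [smul_re, smul_im, add_re, add_im, Complex.add_re, Complex.add_im] <;> module
  zero_smul u := by ext <;> simp

/-- The real scalar action (restriction of scalars) is the complex one on real scalars. [folklore] -/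
theorem real_smul_eq (r : ℝ) (u : Complexification E) : r • u = (r : ℂ) • u :=
  (Complex.coe_smul r u).symm

/-- `re (r • u) = r • re u` for real `r`. [folklore] -/
@[simp] theorem real_smul_re (r : ℝ) (u : Complexification E) : (r • u).re = r • u.re := by
  rw [real_smul_eq, smul_re]; simp

/-- `im (r • u) = r • im u` for real `r`. [folklore] -/
@[simp] theorem real_smul_im (r : ℝ) (u : Complexification E) : (r • u).im = r • u.im := by
  rw [real_smul_eq, smul_im]; simp

/-- `i(x + iy) = -y + ix`. [folklore] -/
theorem I_smul_mk (x y : E) : Complex.I • (⟨x, y⟩ : Complexification E) = ⟨-y, x⟩ := by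
  ext <;> simp

/-- `x + iy = (x + i0) + i(y + i0)`. [folklore] -/
theorem mk_eq_add_I_smul (x y : E) :
    (⟨x, y⟩ : Complexification E) = ⟨x, 0⟩ + Complex.I • ⟨y, 0⟩ := by
  ext <;> simp

/-- **The complexified subspace** `S_ℂ = S ⊕ iS = {x + iy | x, y ∈ S}` of a real subspace `S`,
a complex subspace of `E_ℂ`. [folklore] -/
def submodule (S : Submodule ℝ E) : Submodule ℂ (Complexification E) where
  carrier := {u | u.re ∈ S ∧ u.im ∈ S}
  zero_mem' := ⟨S.zero_mem, S.zero_mem⟩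
  add_mem' hu hv := ⟨S.add_mem hu.1 hv.1, S.add_mem hu.2 hv.2⟩
  smul_mem' _ _ hu :=
    ⟨S.sub_mem (S.smul_mem _ hu.1) (S.smul_mem _ hu.2),
      S.add_mem (S.smul_mem _ hu.2) (S.smul_mem _ hu.1)⟩

/-- Membership in `S_ℂ`: both parts lie in `S`. [folklore] -/
@[simp] theorem mem_submodule_iff {S : Submodule ℝ E} {u : Complexification E} :
    u ∈ submodule S ↔ u.re ∈ S ∧ u.im ∈ S := Iff.rfl

/-- `S ↦ S_ℂ` is monotone. [folklore] -/
theorem submodule_mono {S S' : Submodule ℝ E} (h : S ≤ S') : submodule S ≤ submodule S' :=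
  fun _ hu => ⟨h hu.1, h hu.2⟩

/-- `S_ℂ ≤ S'_ℂ ↔ S ≤ S'` (test on `x + i0`). [folklore] -/
theorem submodule_le_submodule_iff {S S' : Submodule ℝ E} : submodule S ≤ submodule S' ↔ S ≤ S' := by
  refine ⟨fun h x hx => ?_, submodule_mono⟩
  have hu : (⟨x, 0⟩ : Complexification E) ∈ submodule S := ⟨hx, S.zero_mem⟩
  exact (h hu).1

/-- `S ↦ S_ℂ` is injective. [folklore] -/
theorem submodule_inj {S S' : Submodule ℝ E} : submodule S = submodule S' ↔ S = S' := by
  simp only [le_antisymm_iff, submodule_le_submodule_iff]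

/-- `(⊤)_ℂ = ⊤`. [folklore] -/
@[simp] theorem submodule_top : submodule (⊤ : Submodule ℝ E) = ⊤ := by
  ext u; simp

/-- `(⊥)_ℂ = ⊥`. [folklore] -/
@[simp] theorem submodule_bot : submodule (⊥ : Submodule ℝ E) = ⊥ := by
  ext u
  simp only [mem_submodule_iff, Submodule.mem_bot]
  constructor
  · rintro ⟨h1, h2⟩; ext <;> simp [h1, h2]
  · rintro rfl; simp

/-- `(S ⊓ S')_ℂ = S_ℂ ⊓ S'_ℂ`. [folklore] -/
theorem submodule_inf (S S' : Submodule ℝ E) : submodule (S ⊓ S') = submodule S ⊓ submodule S' := by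
  ext u
  simp only [mem_submodule_iff, Submodule.mem_inf]
  tauto

end Module

/-! ## §2. The complex inner product and the norm `‖x + iy‖² = ‖x‖² + ‖y‖²` -/

section Inner

variable [NormedAddCommGroup E] [InnerProductSpace ℝ E]

/-- The complex inner product `⟪x + iy, x' + iy'⟫ = ⟪x, x'⟫ + ⟪y, y'⟫ + i(⟪x, y'⟫ - ⟪y, x'⟫)` as an
`InnerProductSpace.Core` (Hermitian, positive definite, sesquilinear). [folklore] -/
@[reducible]
def innerCore : InnerProductSpace.Core ℂ (Complexification E) where
  inner u v := ⟨⟪u.re, v.re⟫_ℝ + ⟪u.im, v.im⟫_ℝ, ⟪u.re, v.im⟫_ℝ - ⟪u.im, v.re⟫_ℝ⟩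
  conj_inner_symm u v := by
    apply Complex.ext
    · simp only [Complex.conj_re]
      rw [real_inner_comm u.re, real_inner_comm u.im]
    · simp only [Complex.conj_im]
      rw [real_inner_comm u.im, real_inner_comm u.re]
      ring
  re_inner_nonneg u := add_nonneg real_inner_self_nonneg real_inner_self_nonneg
  add_left u v w := by
    apply Complex.ext
    · simp only [add_re, add_im, inner_add_left, Complex.add_re]; ring
    · simp only [add_re, add_im, inner_add_left, Complex.add_im]; ring
  smul_left u v c := by
    apply Complex.ext
    · simp only [smul_re, smul_im, inner_sub_left, inner_add_left, real_inner_smul_left,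
        Complex.mul_re, Complex.conj_re, Complex.conj_im]
      ring
    · simp only [smul_re, smul_im, inner_sub_left, inner_add_left, real_inner_smul_left,
        Complex.mul_im, Complex.conj_re, Complex.conj_im]
      ring
  definite u h := by
    have h1 : ⟪u.re, u.re⟫_ℝ + ⟪u.im, u.im⟫_ℝ = 0 := by simpa using congrArg Complex.re h
    rw [real_inner_self_eq_norm_sq, real_inner_self_eq_norm_sq] at h1
    have hre : ‖u.re‖ ^ 2 = 0 := by nlinarith [sq_nonneg ‖u.re‖, sq_nonneg ‖u.im‖]
    have him : ‖u.im‖ ^ 2 = 0 := by nlinarith [sq_nonneg ‖u.re‖, sq_nonneg ‖u.im‖]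
    rw [sq_eq_zero_iff, norm_eq_zero] at hre him
    ext
    · simpa using hre
    · simpa using him

/-- The norm `‖x + iy‖ = √(‖x‖² + ‖y‖²)` on `E_ℂ`. [folklore] -/
instance instNormedAddCommGroup : NormedAddCommGroup (Complexification E) :=
  @InnerProductSpace.Core.toNormedAddCommGroup ℂ (Complexification E) _ _ _ innerCore

/-- `E_ℂ` is a complex inner product space. [folklore] -/
instance instInnerProductSpace : InnerProductSpace ℂ (Complexification E) :=
  InnerProductSpace.ofCore innerCore.toCore

/-- The complex inner product, unfolded. [folklore] -/
theorem inner_def (u v : Complexification E) :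
    ⟪u, v⟫_ℂ = ⟨⟪u.re, v.re⟫_ℝ + ⟪u.im, v.im⟫_ℝ, ⟪u.re, v.im⟫_ℝ - ⟪u.im, v.re⟫_ℝ⟩ := rfl

/-- `Re ⟪u, v⟫ = ⟪re u, re v⟫ + ⟪im u, im v⟫`. [folklore] -/
@[simp] theorem inner_re (u v : Complexification E) :
    (⟪u, v⟫_ℂ).re = ⟪u.re, v.re⟫_ℝ + ⟪u.im, v.im⟫_ℝ := rfl

/-- `Im ⟪u, v⟫ = ⟪re u, im v⟫ - ⟪im u, re v⟫`. [folklore] -/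
@[simp] theorem inner_im (u v : Complexification E) :
    (⟪u, v⟫_ℂ).im = ⟪u.re, v.im⟫_ℝ - ⟪u.im, v.re⟫_ℝ := rfl

/-- **`‖x + iy‖² = ‖x‖² + ‖y‖²`.** [folklore] -/
theorem norm_sq (u : Complexification E) : ‖u‖ ^ 2 = ‖u.re‖ ^ 2 + ‖u.im‖ ^ 2 := by
  rw [@norm_sq_eq_re_inner ℂ, RCLike.re_to_complex, inner_re, real_inner_self_eq_norm_sq,
    real_inner_self_eq_norm_sq]

/-- `‖x + iy‖ = √(‖x‖² + ‖y‖²)`. [folklore] -/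
theorem norm_eq_sqrt (u : Complexification E) : ‖u‖ = √(‖u.re‖ ^ 2 + ‖u.im‖ ^ 2) := by
  rw [← norm_sq, Real.sqrt_sq (norm_nonneg _)]

/-- `‖re u‖ ≤ ‖u‖`. [folklore] -/
theorem norm_re_le (u : Complexification E) : ‖u.re‖ ≤ ‖u‖ := by
  rw [norm_eq_sqrt, Real.le_sqrt (norm_nonneg _) (by positivity)]
  nlinarith [sq_nonneg ‖u.im‖]

/-- `‖im u‖ ≤ ‖u‖`. [folklore] -/
theorem norm_im_le (u : Complexification E) : ‖u.im‖ ≤ ‖u‖ := by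
  rw [norm_eq_sqrt, Real.le_sqrt (norm_nonneg _) (by positivity)]
  nlinarith [sq_nonneg ‖u.re‖]

/-- `‖u‖ ≤ ‖re u‖ + ‖im u‖`. [folklore] -/
theorem norm_le (u : Complexification E) : ‖u‖ ≤ ‖u.re‖ + ‖u.im‖ := by
  rw [norm_eq_sqrt, Real.sqrt_le_left (by positivity)]
  nlinarith [norm_nonneg u.re, norm_nonneg u.im]

/-- `‖x + i0‖ = ‖x‖`. [folklore] -/
@[simp] theorem norm_mk_zero (x : E) : ‖(⟨x, 0⟩ : Complexification E)‖ = ‖x‖ := by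
  rw [norm_eq_sqrt]
  simp [Real.sqrt_sq (norm_nonneg _)]

/-- **The isometric real-linear embedding `E → E_ℂ`, `x ↦ x + i0`.** [folklore] -/
def ofReal : E →ₗᵢ[ℝ] Complexification E where
  toLinearMap :=
    { toFun := fun x => ⟨x, 0⟩
      map_add' := fun x y => by ext <;> simp
      map_smul' := fun r x => by ext <;> simp }
  norm_map' x := norm_mk_zero x

/-- `re (x + i0) = x`. [folklore] -/
@[simp] theorem ofReal_re (x : E) : (ofReal x).re = x := rfl

/-- `im (x + i0) = 0`. [folklore] -/
@[simp] theorem ofReal_im (x : E) : (ofReal x).im = 0 := rfl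

/-- `ofReal x` is the pair `⟨x, 0⟩`. [folklore] -/
theorem ofReal_apply (x : E) : ofReal x = (⟨x, 0⟩ : Complexification E) := rfl

/-- `x + iy = ofReal x + i • ofReal y`. [folklore] -/
theorem mk_eq_ofReal_add (x y : E) :
    (⟨x, y⟩ : Complexification E) = ofReal x + Complex.I • ofReal y := by
  ext <;> simp

/-- Every vector is `ofReal (re u) + i • ofReal (im u)`. [folklore] -/
theorem eq_ofReal_add (u : Complexification E) : u = ofReal u.re + Complex.I • ofReal u.im := by
  ext <;> simp

/-- **Complexified spans**: `(span_ℝ s)_ℂ = span_ℂ (s + i0)`; in particular the complexification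
of a finite-dimensional real subspace is spanned over `ℂ` by (the images of) the same vectors. [folklore] -/
theorem submodule_span (s : Set E) :
    submodule (Submodule.span ℝ s) = Submodule.span ℂ (ofReal '' s) := by
  apply le_antisymm
  · intro u hu
    -- the real span of `s + i0` lies in the complex span
    have key : ∀ x ∈ Submodule.span ℝ s, ofReal x ∈ Submodule.span ℂ (ofReal '' s) := by
      intro x hx
      have hx' : ofReal x ∈ (Submodule.span ℝ s).map (ofReal (E := E)).toLinearMap :=
        Submodule.mem_map_of_mem hx
      rw [Submodule.map_span] at hx'
      exact Submodule.span_le_restrictScalars ℝ ℂ _ hx'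
    rw [eq_ofReal_add u]
    exact Submodule.add_mem _ (key _ hu.1) (Submodule.smul_mem _ _ (key _ hu.2))
  · rw [Submodule.span_le]
    rintro _ ⟨x, hx, rfl⟩
    exact ⟨Submodule.subset_span hx, Submodule.zero_mem _⟩

/-- `⟪x + i0, x' + i0⟫ = ⟪x, x'⟫`: the embedding is compatible with the inner products. [folklore] -/
@[simp] theorem inner_ofReal_ofReal (x y : E) : ⟪ofReal x, ofReal y⟫_ℂ = (⟪x, y⟫_ℝ : ℂ) := by
  apply Complex.ext <;> simp

/-- `re : E_ℂ → E` as a continuous real-linear map. [folklore] -/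
def reL : Complexification E →L[ℝ] E :=
  LinearMap.mkContinuous
    { toFun := re
      map_add' := fun _ _ => rfl
      map_smul' := fun r u => real_smul_re r u }
    1 fun u => by simpa using norm_re_le u

/-- `im : E_ℂ → E` as a continuous real-linear map. [folklore] -/
def imL : Complexification E →L[ℝ] E :=
  LinearMap.mkContinuous
    { toFun := im
      map_add' := fun _ _ => rfl
      map_smul' := fun r u => real_smul_im r u }
    1 fun u => by simpa using norm_im_le u

/-- `reL u = re u`. [folklore] -/
@[simp] theorem reL_apply (u : Complexification E) : reL u = u.re := rfl

/-- `imL u = im u`. [folklore] -/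
@[simp] theorem imL_apply (u : Complexification E) : imL u = u.im := rfl

/-- `re` is continuous. [folklore] -/
@[continuity, fun_prop]
theorem continuous_re : Continuous (re : Complexification E → E) := reL.continuous

/-- `im` is continuous. [folklore] -/
@[continuity, fun_prop]
theorem continuous_im : Continuous (im : Complexification E → E) := imL.continuous

/-- **`E_ℂ ≃L[ℝ] E × E`** as real topological vector spaces (`x + iy ↦ (x, y)`; the norms are
equivalent, `max ≤ ‖·‖_{E_ℂ} ≤ sum`). [folklore] -/
def prodL : Complexification E ≃L[ℝ] E × E :=
  LinearEquiv.toContinuousLinearEquivOfBounds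
    { toFun := fun u => (u.re, u.im)
      invFun := fun p => ⟨p.1, p.2⟩
      map_add' := fun _ _ => rfl
      map_smul' := fun r u => by ext <;> simp
      left_inv := fun _ => rfl
      right_inv := fun _ => rfl }
    1 2
    (fun u => by
      rw [one_mul, LinearEquiv.coe_mk, Prod.norm_def]
      exact max_le (norm_re_le u) (norm_im_le u))
    (fun p => by
      refine (norm_le _).trans ?_
      change ‖p.1‖ + ‖p.2‖ ≤ 2 * ‖p‖
      rw [Prod.norm_def, two_mul]
      exact add_le_add (le_max_left _ _) (le_max_right _ _))

/-- `prodL u = (re u, im u)`. [folklore] -/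
@[simp] theorem prodL_apply (u : Complexification E) : prodL u = (u.re, u.im) := rfl

/-- `prodL⁻¹ (x, y) = x + iy`. [folklore] -/
@[simp] theorem prodL_symm_apply (p : E × E) : prodL.symm p = (⟨p.1, p.2⟩ : Complexification E) :=
  rfl

/-- A pair of continuous maps into `E` gives a continuous map into `E_ℂ`. [folklore] -/
theorem continuous_mk {X : Type*} [TopologicalSpace X] {f g : X → E} (hf : Continuous f)
    (hg : Continuous g) : Continuous fun t => (⟨f t, g t⟩ : Complexification E) :=
  (prodL (E := E)).symm.continuous.comp (hf.prodMk hg)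

/-- `E_ℂ` is complete when `E` is (a Hilbert space complexifies to a Hilbert space). [folklore] -/
instance instCompleteSpace [CompleteSpace E] : CompleteSpace (Complexification E) :=
  (completeSpace_congr (e := (prodL (E := E)).toLinearEquiv.toEquiv)
    (prodL (E := E)).isUniformEmbedding).mpr inferInstance

/-- A closed real subspace complexifies to a closed complex subspace. [folklore] -/
theorem isClosed_submodule {S : Submodule ℝ E} (hS : IsClosed (S : Set E)) :
    IsClosed (submodule S : Set (Complexification E)) := by
  have h : (submodule S : Set (Complexification E)) = re ⁻¹' S ∩ im ⁻¹' S := by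
    ext u; simp
  rw [h]
  exact (hS.preimage continuous_re).inter (hS.preimage continuous_im)

/-! ## §3. Complexification of bounded real operators -/

/-- **The complexification `T_ℂ` of a bounded real operator**: `T_ℂ (x + iy) = Tx + iTy`, a bounded
complex-linear operator on `E_ℂ` with `‖T_ℂ‖ ≤ ‖T‖`. [folklore] -/
def map (T : E →L[ℝ] E) : Complexification E →L[ℂ] Complexification E :=
  LinearMap.mkContinuous
    { toFun := fun u => ⟨T u.re, T u.im⟩
      map_add' := fun u v => by ext <;> simp
      map_smul' := fun c u => by ext <;> simp }
    ‖T‖ fun u => by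
      change ‖(⟨T u.re, T u.im⟩ : Complexification E)‖ ≤ ‖T‖ * ‖u‖
      rw [norm_eq_sqrt, norm_eq_sqrt u, Real.sqrt_le_left (by positivity), mul_pow,
        Real.sq_sqrt (by positivity), mul_add]
      simp only
      rw [← mul_pow, ← mul_pow]
      exact add_le_add (pow_le_pow_left₀ (norm_nonneg _) (T.le_opNorm _) 2)
        (pow_le_pow_left₀ (norm_nonneg _) (T.le_opNorm _) 2)

/-- `re (T_ℂ u) = T (re u)`. [folklore] -/
@[simp] theorem map_apply_re (T : E →L[ℝ] E) (u : Complexification E) : (map T u).re = T u.re :=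
  rfl

/-- `im (T_ℂ u) = T (im u)`. [folklore] -/
@[simp] theorem map_apply_im (T : E →L[ℝ] E) (u : Complexification E) : (map T u).im = T u.im :=
  rfl

/-- `T_ℂ (x + iy) = Tx + iTy`. [folklore] -/
theorem map_mk (T : E →L[ℝ] E) (x y : E) : map T ⟨x, y⟩ = (⟨T x, T y⟩ : Complexification E) := rfl

/-- `T_ℂ (x + i0) = Tx + i0`: `T_ℂ` extends `T`. [folklore] -/
@[simp] theorem map_ofReal (T : E →L[ℝ] E) (x : E) : map T (ofReal x) = ofReal (T x) := by
  ext <;> simp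

/-- `(1)_ℂ = 1`. [folklore] -/
@[simp] theorem map_id : map (ContinuousLinearMap.id ℝ E) = ContinuousLinearMap.id ℂ _ := by
  ext u <;> rfl

/-- Functoriality: `(S ∘ T)_ℂ = S_ℂ ∘ T_ℂ`. [folklore] -/
theorem map_comp (S T : E →L[ℝ] E) : map (S.comp T) = (map S).comp (map T) := by
  ext u <;> rfl

/-- `(S T)_ℂ = S_ℂ T_ℂ` (multiplicative form of `map_comp`). [folklore] -/
theorem map_mul (S T : E →L[ℝ] E) : map (S * T) = map S * map T := map_comp S T

/-- `(1)_ℂ = 1` (monoid form of `map_id`). [folklore] -/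
@[simp] theorem map_one : map (1 : E →L[ℝ] E) = 1 := map_id

/-- `(S + T)_ℂ = S_ℂ + T_ℂ`. [folklore] -/
theorem map_add (S T : E →L[ℝ] E) : map (S + T) = map S + map T := by
  ext u <;> rfl

/-- `(0)_ℂ = 0`. [folklore] -/
@[simp] theorem map_zero : map (0 : E →L[ℝ] E) = 0 := by
  ext u <;> rfl

/-- `(r T)_ℂ = r T_ℂ` for real `r`. [folklore] -/
theorem map_smul (r : ℝ) (T : E →L[ℝ] E) : map (r • T) = (r : ℂ) • map T := by
  ext u <;> simp

/-- An inner-product preserving real operator complexifies to an inner-product preserving one. [folklore] -/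
theorem inner_map_map {T : E →L[ℝ] E} (hT : ∀ x y, ⟪T x, T y⟫_ℝ = ⟪x, y⟫_ℝ)
    (u v : Complexification E) : ⟪map T u, map T v⟫_ℂ = ⟪u, v⟫_ℂ := by
  apply Complex.ext <;> simp [hT]

/-- A norm preserving real operator complexifies to a norm preserving one. [folklore] -/
theorem norm_map_apply {T : E →L[ℝ] E} (hT : ∀ x, ‖T x‖ = ‖x‖) (u : Complexification E) :
    ‖map T u‖ = ‖u‖ := by
  rw [norm_eq_sqrt, norm_eq_sqrt u, map_apply_re, map_apply_im, hT, hT]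

/-- **The complexification of a surjective real linear isometry as a unitary**: for `T` norm
preserving with two-sided inverse `S`, the linear isometric equivalence `T_ℂ` of `E_ℂ` with inverse
`S_ℂ`. [folklore] -/
def mapEquiv {T S : E →L[ℝ] E} (hT : ∀ x, ‖T x‖ = ‖x‖) (h₁ : S.comp T = ContinuousLinearMap.id ℝ E)
    (h₂ : T.comp S = ContinuousLinearMap.id ℝ E) :
    Complexification E ≃ₗᵢ[ℂ] Complexification E where
  toLinearEquiv :=
    { (map T).toLinearMap with
      invFun := map S
      left_inv := fun u => by
        change map S (map T u) = u
        rw [← ContinuousLinearMap.comp_apply, ← map_comp, h₁, map_id]; rfl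
      right_inv := fun u => by
        change map T (map S u) = u
        rw [← ContinuousLinearMap.comp_apply, ← map_comp, h₂, map_id]; rfl }
  norm_map' := norm_map_apply hT

/-- `mapEquiv` acts as `T_ℂ`. [folklore] -/
@[simp] theorem mapEquiv_apply {T S : E →L[ℝ] E} (hT : ∀ x, ‖T x‖ = ‖x‖)
    (h₁ : S.comp T = ContinuousLinearMap.id ℝ E) (h₂ : T.comp S = ContinuousLinearMap.id ℝ E)
    (u : Complexification E) : mapEquiv hT h₁ h₂ u = map T u := rfl

/-- **`T_ℂ` is unitary** when `T` is a norm preserving real operator with a two-sided inverse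
(a real orthogonal operator complexifies to a unitary one). [folklore] -/
theorem map_mem_unitary [CompleteSpace E] {T S : E →L[ℝ] E} (hT : ∀ x, ‖T x‖ = ‖x‖)
    (h₁ : S.comp T = ContinuousLinearMap.id ℝ E) (h₂ : T.comp S = ContinuousLinearMap.id ℝ E) :
    map T ∈ unitary (Complexification E →L[ℂ] Complexification E) := by
  have h : ((mapEquiv hT h₁ h₂ : Complexification E ≃ₗᵢ[ℂ] Complexification E) :
      Complexification E →L[ℂ] Complexification E) = map T := by
    ext u <;> rfl
  rw [← h]
  exact (Unitary.linearIsometryEquiv.symm (mapEquiv hT h₁ h₂)).property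

/-! ## §4. Real orthogonal one-parameter groups as one-parameter unitary groups -/

section Group

variable [CompleteSpace E]

/-- **Complexification of a strongly continuous one-parameter group of real linear isometries.**
For `V : ℝ → (E →L[ℝ] E)` with `V 0 = 1`, `V (s + t) = V s ∘ V t`, `‖V t x‖ = ‖x‖` and
`t ↦ V t x` continuous (e.g. the Koopman group of a measure-preserving flow on a real `L²`-type
space), the strongly continuous one-parameter UNITARY group `U(t) = (V t)_ℂ` on `E_ℂ`
(`OneParameterUnitaryGroup`, so that `UnitaryRep.hamiltonian`, `invariantVectors`, the Mourre
classes of `ConjugateOperatorRegularity.lean`, … apply). [folklore] -/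
def unitaryGroupOfReal (V : ℝ → E →L[ℝ] E) (h0 : V 0 = ContinuousLinearMap.id ℝ E)
    (hadd : ∀ s t, V (s + t) = (V s).comp (V t)) (hnorm : ∀ t x, ‖V t x‖ = ‖x‖)
    (hcont : ∀ x, Continuous fun t => V t x) : OneParameterUnitaryGroup (Complexification E) where
  toMonoidHom :=
    { toFun := fun g => map (V (Multiplicative.toAdd g))
      map_one' := by rw [toAdd_one, h0, map_id]; rfl
      map_mul' := fun g h => by rw [toAdd_mul, hadd, map_comp]; rfl }
  strongly_continuous := fun u => by
    change Continuous fun g : Multiplicative ℝ =>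
      (⟨V (Multiplicative.toAdd g) u.re, V (Multiplicative.toAdd g) u.im⟩ : Complexification E)
    exact continuous_mk ((hcont u.re).comp continuous_toAdd) ((hcont u.im).comp continuous_toAdd)
  mem_unitary := fun g =>
    map_mem_unitary (hnorm _) (S := V (-Multiplicative.toAdd g))
      (by rw [← hadd, neg_add_cancel, h0]) (by rw [← hadd, add_neg_cancel, h0])

variable {V : ℝ → E →L[ℝ] E} {h0 : V 0 = ContinuousLinearMap.id ℝ E}
  {hadd : ∀ s t, V (s + t) = (V s).comp (V t)} {hnorm : ∀ t x, ‖V t x‖ = ‖x‖}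
  {hcont : ∀ x, Continuous fun t => V t x}

/-- `U(g) = (V g)_ℂ` (representation form). [folklore] -/
theorem unitaryGroupOfReal_apply (g : Multiplicative ℝ) :
    (unitaryGroupOfReal V h0 hadd hnorm hcont) g = map (V (Multiplicative.toAdd g)) := rfl

/-- `U(t) = (V t)_ℂ`. [folklore] -/
@[simp] theorem unitaryGroupOfReal_appReal (t : ℝ) :
    (unitaryGroupOfReal V h0 hadd hnorm hcont).appReal t = map (V t) := rfl

/-- `U(t) (x + iy) = V t x + i V t y`. [folklore] -/
theorem unitaryGroupOfReal_appReal_apply (t : ℝ) (u : Complexification E) :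
    (unitaryGroupOfReal V h0 hadd hnorm hcont).appReal t u = ⟨V t u.re, V t u.im⟩ := rfl

/-- `U(t) (x + i0) = V t x + i0`: the unitary group extends the real one. [folklore] -/
theorem unitaryGroupOfReal_appReal_ofReal (t : ℝ) (x : E) :
    (unitaryGroupOfReal V h0 hadd hnorm hcont).appReal t (ofReal x) = ofReal (V t x) :=
  map_ofReal _ _

/-- **Invariant vectors of the complexified group**: `x + iy` is `U`-invariant iff `x` and `y` are
`V`-invariant. [folklore] -/
theorem mem_invariantVectors_unitaryGroupOfReal_iff {u : Complexification E} :
    u ∈ (unitaryGroupOfReal V h0 hadd hnorm hcont).invariantVectors ↔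
      (∀ t, V t u.re = u.re) ∧ ∀ t, V t u.im = u.im := by
  rw [UnitaryRep.mem_invariantVectors_iff]
  constructor
  · intro h
    refine ⟨fun t => ?_, fun t => ?_⟩
    · simpa [unitaryGroupOfReal_apply] using congrArg re (h (Multiplicative.ofAdd t))
    · simpa [unitaryGroupOfReal_apply] using congrArg im (h (Multiplicative.ofAdd t))
  · rintro ⟨h1, h2⟩ g
    change map (V (Multiplicative.toAdd g)) u = u
    ext
    · simpa using h1 (Multiplicative.toAdd g)
    · simpa using h2 (Multiplicative.toAdd g)

/-- If the real orbit `t ↦ V t x` has derivative `y` at `0`, the complex orbit `t ↦ U(t)(x + i0)`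
has derivative `y + i0` at `0`. [folklore] -/
theorem hasDerivAt_unitaryGroupOfReal_ofReal {x y : E} (h : HasDerivAt (fun t => V t x) y 0) :
    HasDerivAt (fun t => (unitaryGroupOfReal V h0 hadd hnorm hcont).appReal t (ofReal x))
      (ofReal y) 0 := by
  have h' := ((ofReal (E := E)).toContinuousLinearMap.hasFDerivAt).comp_hasDerivAt (0 : ℝ) h
  have h2 : (fun t => (unitaryGroupOfReal V h0 hadd hnorm hcont).appReal t (ofReal x)) =
      ((ofReal (E := E)).toContinuousLinearMap ∘ fun t => V t x) := by
    funext t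
    exact map_ofReal _ _
  rw [h2]
  exact h'

/-- **The Stone generator extends the real generator**: if `t ↦ V t x` has derivative `y` at `0`
(`x` in the domain of the real generator, `y` its value), then `x + i0 ∈ D(H)` for the Hamiltonian
`H = -i d/dt|₀ U(t)` of the complexified group and `H (x + i0) = -i (y + i0)`. [folklore] -/
theorem hamiltonian_unitaryGroupOfReal_ofReal {x y : E} (h : HasDerivAt (fun t => V t x) y 0) :
    ∃ hx : ofReal x ∈ (unitaryGroupOfReal V h0 hadd hnorm hcont).hamiltonian.domain,
      (unitaryGroupOfReal V h0 hadd hnorm hcont).hamiltonian ⟨ofReal x, hx⟩ =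
        (-Complex.I) • ofReal y := by
  set U := unitaryGroupOfReal V h0 hadd hnorm hcont
  have hd : HasDerivAt (fun t : ℝ => OneParameterGroup.app U.toStrongContRepresentation t (ofReal x))
      (ofReal y) 0 := by
    simpa only [UnitaryRep.app_toStrongContRepresentation] using
      hasDerivAt_unitaryGroupOfReal_ofReal (h0 := h0) (hadd := hadd) (hnorm := hnorm)
        (hcont := hcont) h
  obtain ⟨hx, hval⟩ :=
    OneParameterGroup.mem_generator_domain_of_hasDerivAt U.toStrongContRepresentation hd
  refine ⟨hx, ?_⟩
  rw [UnitaryRep.hamiltonian_apply]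
  congr 1

end Group

end Inner

end Complexification

end Literature.Analysis.UnboundedOperators
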